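import Literature.Computability.AlgebraicComplexity.LaserMethodTheorem
import Literature.Computability.AlgebraicComplexity.DegenerationSpectralMonotone
import Literature.Computability.AlgebraicComplexity.AsymptoticRankMatMul
import Literature.Barriers.MatrixMultiplication.RectangularBarrier
import Summits.MatrixMultiplication.MatrixMultiplication.Theorems.OctonionicLaserOctLaserBoundFreeDiagonal
import HarnessLib

/-!
# Route OctonionicLaser — crux `OctSpectralDominance` (stmt-MatrixMultiplication-7931), helper file:
# the laser method bounds EVERY universal spectral point (BCS Thm. 15.41, spectral form, signed components)

Support lemmas for the weight-basis laser analysis of the octonion tensor `t₈`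
(`OctonionicLaserOctSpectralDominanceWeightLaser.lean`).  The tree's laser theorem
`BCS1997_thm1541` (`LaserMethodTheorem.lean`) concludes `min_m H(P_m) + ω/3 · ∑ P log₂ vol ≤ log₂ R̃(t)`.
Its proof actually produces, at every power `N = d·M`, a RESTRICTION `t^{⊗N} ≥ ⊕_{δ∈Δ} ⟨K, M, N⟩` to a
direct sum of `|Δ| ≳ 2^{N min H}` EQUAL matrix tensors (under the consistency hypotheses of the theorem the
format of a block of the typed support is determined by the marginal types, not only its volume —
`laserShape_eq`), so the same construction bounds every universal spectral point `F`
(additive, multiplicative, monotone, normalised): for a rational distribution `P = c/d` on the tight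
support,

  `d · min_m H(P_m) + log₂ F(⟨∏ k_s^{c_s}, ∏ m_s^{c_s}, ∏ n_s^{c_s}⟩) ≤ d · log₂ F(t)`

(`laser_spectral_of_counts`).  Components are allowed to be matrix tensors up to SIGNED relabellings
(`εI εJ εL`, `ε² = 1`, the form needed for `t₈`; restriction layer
`tensorRestrictsTo_kroneckerPow_matMulDirectSum_of_free_signed` of
`OctonionicLaserOctLaserBoundFreeDiagonal.lean`).  The combinatorial layer (typed supports, free
diagonals by hashing, Behrend) is the tree's (`LaserMethodTypes.lean`), and so is the real-analysis
core (`laser_step_algebra`, `le_of_forall_mul_le_add_err`, used with `ω := 3`, `V := F(B_c)^M`,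
`R_ε := F(t)`).  Everything is proved; no definitions, no named facts.

## References

* [BurgisserClausenShokrollahi1997] P. Bürgisser, M. Clausen, M. A. Shokrollahi, *Algebraic Complexity
  Theory*, Springer 1997, §15.6 Prop. 15.30, §15.8 (15.40), Thm. 15.41 and its proof pp. 380–382.
* [Strassen1988] V. Strassen, *The asymptotic spectrum of tensors*, J. reine angew. Math. 384 (1988), §3
  (spectral points are monotone under degeneration/restriction, additive and multiplicative).
* [ChristandlVranaZuiddam2023] M. Christandl, P. Vrana, J. Zuiddam, *Universal points in the asymptotic
  spectrum of tensors*, J. AMS 36 (2023), §1.2.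
-/

noncomputable section

open scoped BigOperators
open Finset

-- the tree's namespace `Summit.MatrixMultiplication.MatrixMultiplication.…` repeats a component by design
set_option linter.dupNamespace false

namespace Summit.MatrixMultiplication.MatrixMultiplication.Theorems

open Literature.Computability.AlgebraicComplexity

universe u

/-! ## A direct sum of equal matrix tensors is `⟨p⟩ ⊗ ⟨K, M, N⟩` -/

section ConstShape

variable {K : Type u} [CommSemiring K]

/-- **`⊕_{i<p} ⟨kᵢ, mᵢ, nᵢ⟩ ≥ ⟨p⟩ ⊗ ⟨K₀, M₀, N₀⟩` when all formats equal `(K₀, M₀, N₀)`** (the direct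
sum of `p` equal matrix tensors is, up to relabelling the block index, the Kronecker product of the
unit tensor `⟨p⟩` with the common block; Bläser 2013 §7, CVZ 2023 §1.1). [folklore] -/
theorem tensorRestrictsTo_matMulDirectSum_unit_kronecker {p : ℕ} (kf mf nf : Fin p → ℕ)
    (K₀ M₀ N₀ : ℕ) (hk : ∀ i, kf i = K₀) (hm : ∀ i, mf i = M₀) (hn : ∀ i, nf i = N₀) :
    TensorRestrictsTo (matMulDirectSum K kf mf nf)
      (kroneckerTensor (unitTensor K p) (matMulTensor K K₀ M₀ N₀)) := by
  classical
  have key : kroneckerTensor (unitTensor K p) (matMulTensor K K₀ M₀ N₀) = fun a b c =>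
      matMulDirectSum K kf mf nf
        ⟨a.1, (Fin.cast (hk a.1).symm a.2.1, Fin.cast (hn a.1).symm a.2.2)⟩
        ⟨b.1, (Fin.cast (hk b.1).symm b.2.1, Fin.cast (hm b.1).symm b.2.2)⟩
        ⟨c.1, (Fin.cast (hm c.1).symm c.2.1, Fin.cast (hn c.1).symm c.2.2)⟩ := by
    funext a b c
    simp only [kroneckerTensor_apply, unitTensor_apply, matMulTensor, matMulDirectSum, Fin.val_cast,
      Fin.ext_iff]
    by_cases h1 : (a.1 : ℕ) = b.1 ∧ (b.1 : ℕ) = c.1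
    · by_cases h2 : (a.2.1 : ℕ) = b.2.1 ∧ (b.2.2 : ℕ) = c.2.1 ∧ (a.2.2 : ℕ) = c.2.2
      · rw [if_pos h1, if_pos h2, if_pos ⟨h1.1, h1.2, h2.1, h2.2.1, h2.2.2⟩, one_mul]
      · rw [if_neg h2, mul_zero, if_neg (fun h => h2 ⟨h.2.2.1, h.2.2.2.1, h.2.2.2.2⟩)]
    · rw [if_neg h1, zero_mul, if_neg (fun h => h1 ⟨h.1, h.2.1⟩)]
  rw [key]
  exact tensorRestrictsTo_precomp _ _ _ _

end ConstShape

/-! ## The format of a block of the typed support is determined by the types -/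

section Shape

variable {I J L : Type*} [Fintype I] [Fintype J] [Fintype L] [DecidableEq I] [DecidableEq J]
  [DecidableEq L]

/-- **The three dimensions of a block of the typed support only depend on the types** (refines BCS
p. 381, where this is observed for the volume): if the formats are consistent with block dimensions
(`k n = dI`, `k m = dJ`, `m n = dL` on `S`) and positive on `S`, then for the marginal types of a count
vector `Q` supported in `S` every block `(x, y, z) ∈ Φ` has
`∏_ρ k = ∏_s k_s^{Q s}`, `∏_ρ m = ∏_s m_s^{Q s}`, `∏_ρ n = ∏_s n_s^{Q s}`.
[cite: BurgisserClausenShokrollahi1997, Thm. 15.41 (proof, p. 381)] -/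
theorem laserShape_eq (S : Finset (I × J × L)) (k m n : I × J × L → ℕ) (dI : I → ℕ)
    (dJ : J → ℕ) (dL : L → ℕ) (hdI : ∀ s ∈ S, k s * n s = dI s.1)
    (hdJ : ∀ s ∈ S, k s * m s = dJ s.2.1) (hdL : ∀ s ∈ S, m s * n s = dL s.2.2)
    (hpos : ∀ s ∈ S, 1 ≤ k s ∧ 1 ≤ m s ∧ 1 ≤ n s)
    (Q : I × J × L → ℕ) (hQS : ∀ s, s ∉ S → Q s = 0) {N : ℕ}
    {φ : (Fin N → I) × (Fin N → J) × (Fin N → L)}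
    (hφ : φ ∈ typedSupport S N (fun i => ∑ j, ∑ l, Q (i, j, l)) (fun j => ∑ i, ∑ l, Q (i, j, l))
      (fun l => ∑ i, ∑ j, Q (i, j, l))) :
    (∏ ρ, k (labelSeq φ ρ)) = ∏ s, k s ^ Q s ∧ (∏ ρ, m (labelSeq φ ρ)) = ∏ s, m s ^ Q s ∧
      (∏ ρ, n (labelSeq φ ρ)) = ∏ s, n s ^ Q s := by
  obtain ⟨h1, h2, h3, h4⟩ := mem_typedSupport.1 hφ
  -- the three pairwise products are determined by the types
  have hkn : (∏ ρ, k (labelSeq φ ρ)) * (∏ ρ, n (labelSeq φ ρ)) =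
      (∏ s, k s ^ Q s) * (∏ s, n s ^ Q s) := by
    rw [← Finset.prod_mul_distrib, ← Finset.prod_mul_distrib]
    calc ∏ ρ, k (labelSeq φ ρ) * n (labelSeq φ ρ) = ∏ ρ, dI (φ.1 ρ) :=
          Finset.prod_congr rfl fun ρ _ => hdI _ (h4 ρ)
      _ = ∏ i, dI i ^ (∑ j, ∑ l, Q (i, j, l)) := by
          rw [prod_apply_eq_prod_pow_letterCount dI φ.1, h1]
      _ = ∏ s, dI s.1 ^ Q s := prod_pow_marginal₁ dI Q
      _ = ∏ s, (k s * n s) ^ Q s := by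
          refine Finset.prod_congr rfl fun s _ => ?_
          by_cases hs : s ∈ S
          · rw [hdI s hs]
          · rw [hQS s hs, pow_zero, pow_zero]
      _ = ∏ s, k s ^ Q s * n s ^ Q s := Finset.prod_congr rfl fun s _ => mul_pow _ _ _
  have hkm : (∏ ρ, k (labelSeq φ ρ)) * (∏ ρ, m (labelSeq φ ρ)) =
      (∏ s, k s ^ Q s) * (∏ s, m s ^ Q s) := by
    rw [← Finset.prod_mul_distrib, ← Finset.prod_mul_distrib]
    calc ∏ ρ, k (labelSeq φ ρ) * m (labelSeq φ ρ) = ∏ ρ, dJ (φ.2.1 ρ) :=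
          Finset.prod_congr rfl fun ρ _ => hdJ _ (h4 ρ)
      _ = ∏ j, dJ j ^ (∑ i, ∑ l, Q (i, j, l)) := by
          rw [prod_apply_eq_prod_pow_letterCount dJ φ.2.1, h2]
      _ = ∏ s, dJ s.2.1 ^ Q s := prod_pow_marginal₂ dJ Q
      _ = ∏ s, (k s * m s) ^ Q s := by
          refine Finset.prod_congr rfl fun s _ => ?_
          by_cases hs : s ∈ S
          · rw [hdJ s hs]
          · rw [hQS s hs, pow_zero, pow_zero]
      _ = ∏ s, k s ^ Q s * m s ^ Q s := Finset.prod_congr rfl fun s _ => mul_pow _ _ _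
  have hmn : (∏ ρ, m (labelSeq φ ρ)) * (∏ ρ, n (labelSeq φ ρ)) =
      (∏ s, m s ^ Q s) * (∏ s, n s ^ Q s) := by
    rw [← Finset.prod_mul_distrib, ← Finset.prod_mul_distrib]
    calc ∏ ρ, m (labelSeq φ ρ) * n (labelSeq φ ρ) = ∏ ρ, dL (φ.2.2 ρ) :=
          Finset.prod_congr rfl fun ρ _ => hdL _ (h4 ρ)
      _ = ∏ l, dL l ^ (∑ i, ∑ j, Q (i, j, l)) := by
          rw [prod_apply_eq_prod_pow_letterCount dL φ.2.2, h3]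
      _ = ∏ s, dL s.2.2 ^ Q s := prod_pow_marginal₃ dL Q
      _ = ∏ s, (m s * n s) ^ Q s := by
          refine Finset.prod_congr rfl fun s _ => ?_
          by_cases hs : s ∈ S
          · rw [hdL s hs]
          · rw [hQS s hs, pow_zero, pow_zero]
      _ = ∏ s, m s ^ Q s * n s ^ Q s := Finset.prod_congr rfl fun s _ => mul_pow _ _ _
  -- positivity of all six products
  have hposρ : ∀ ρ, 1 ≤ k (labelSeq φ ρ) ∧ 1 ≤ m (labelSeq φ ρ) ∧ 1 ≤ n (labelSeq φ ρ) :=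
    fun ρ => hpos _ (h4 ρ)
  have hA : 0 < ∏ ρ, k (labelSeq φ ρ) := Finset.prod_pos fun ρ _ => (hposρ ρ).1
  have hB : 0 < ∏ ρ, m (labelSeq φ ρ) := Finset.prod_pos fun ρ _ => (hposρ ρ).2.1
  have hC : 0 < ∏ ρ, n (labelSeq φ ρ) := Finset.prod_pos fun ρ _ => (hposρ ρ).2.2
  have hpow : ∀ (g : I × J × L → ℕ), (∀ s ∈ S, 1 ≤ g s) → 0 < ∏ s, g s ^ Q s := by
    intro g hg
    refine Finset.prod_pos fun s _ => ?_
    by_cases hs : s ∈ S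
    · exact pow_pos (hg s hs) _
    · rw [hQS s hs, pow_zero]; exact one_pos
  have hA' : 0 < ∏ s, k s ^ Q s := hpow k fun s hs => (hpos s hs).1
  have hB' : 0 < ∏ s, m s ^ Q s := hpow m fun s hs => (hpos s hs).2.1
  have hC' : 0 < ∏ s, n s ^ Q s := hpow n fun s hs => (hpos s hs).2.2
  -- `A² (B'C') = (AB)(AC)/(BC)·… `: solve for the three factors
  set A := ∏ ρ, k (labelSeq φ ρ)
  set B := ∏ ρ, m (labelSeq φ ρ)
  set C := ∏ ρ, n (labelSeq φ ρ)
  set A' := ∏ s, k s ^ Q s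
  set B' := ∏ s, m s ^ Q s
  set C' := ∏ s, n s ^ Q s
  have hAA : A = A' := by
    have e : (A * A) * (B * C) = (A' * A') * (B * C) := by
      calc (A * A) * (B * C) = (A * B) * (A * C) := by ring
        _ = (A' * B') * (A' * C') := by rw [hkm, hkn]
        _ = (A' * A') * (B' * C') := by ring
        _ = (A' * A') * (B * C) := by rw [hmn]
    have e2 : A * A = A' * A' := Nat.eq_of_mul_eq_mul_right (Nat.mul_pos hB hC) e
    exact Nat.pow_left_injective two_ne_zero (by simpa [pow_two] using e2)
  have hBB : B = B' := by
    have e : A' * B = A' * B' := by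
      calc A' * B = A * B := by rw [hAA]
        _ = A' * B' := hkm
    exact Nat.eq_of_mul_eq_mul_left hA' e
  have hCC : C = C' := by
    have e : A' * C = A' * C' := by
      calc A' * C = A * C := by rw [hAA]
        _ = A' * C' := hkn
    exact Nat.eq_of_mul_eq_mul_left hA' e
  exact ⟨hAA, hBB, hCC⟩

end Shape

/-! ## Values of a universal spectral point: positivity -/

section Values

variable {K : Type u} [Field K]

/-- `1 ≤ F(t)` for a non-zero tensor `t` and a universal spectral point `F` (`t ≥ ⟨1⟩`, `F(⟨1⟩) = 1`).
[cite: ChristandlVranaZuiddam2023, §1.2] -/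
theorem one_le_spectral_of_ne_zero {F : SpectralMap K} (hF : IsUniversalSpectralPoint K F)
    {ι κ μ : Type} [Fintype ι] [Fintype κ] [Fintype μ] {t : ι → κ → μ → K} (ht : t ≠ 0) :
    1 ≤ F t := by
  rw [← hF.map_unitTensor_one]
  exact hF.mono _ _ (TensorClass.restrictsTo_unitTensor_one_of_ne_zero ht)

/-- A matrix tensor with positive dimensions is non-zero. [folklore] -/
theorem matMulTensor_ne_zero {a b c : ℕ} (ha : 0 < a) (hb : 0 < b) (hc : 0 < c) :
    matMulTensor K a b c ≠ 0 := by
  intro h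
  have e := congrFun (congrFun (congrFun h (⟨0, ha⟩, ⟨0, hc⟩)) (⟨0, ha⟩, ⟨0, hb⟩)) (⟨0, hb⟩, ⟨0, hc⟩)
  simp [matMulTensor] at e

end Values

/-! ## The spectral master inequality at a fixed power -/

section Master

variable {K : Type} [Field K]
variable {ι κ μ : Type} [Fintype ι] [Fintype κ] [Fintype μ] [DecidableEq ι] [DecidableEq κ]
  [DecidableEq μ]
variable {I J L : Type*} [Fintype I] [Fintype J] [Fintype L] [DecidableEq I] [DecidableEq J]
  [DecidableEq L]

/-- **BCS Thm. 15.41 at a fixed power `N`, spectral form** (proof, p. 381, (B)–(C), with a universal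
spectral point in place of the rank): for the marginal types of a count vector `Q` (supported in the
tight set `S`, `∑ Q = N`) there is `1 ≤ f ≤ |Φ|` with
`min{|I_μ|,|J_ν|,|L_π|} · f · rothNumberNat(3f') · F(⟨∏ k^Q, ∏ m^Q, ∏ n^Q⟩) ≤ 288 f'² · F(t)^N`,
`f' = max(f,b)`: the free diagonal `Δ` of the typed support (`exists_free_diagonal_typedSupport`) gives
`t^{⊗N} ≥ ⊕_Δ ⟨∏k, ∏m, ∏n⟩ ≥ ⟨|Δ|⟩ ⊗ ⟨∏ k^Q, ∏ m^Q, ∏ n^Q⟩` (signed components; all blocks have this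
format by `laserShape_eq`), and `F` is monotone, multiplicative, `F(⟨p⟩) = p`, `F(t^{⊗N}) = F(t)^N`.
[cite: BurgisserClausenShokrollahi1997, Thm. 15.41 (proof, p. 381)] -/
theorem laser_spectral_master (t : ι → κ → μ → K) (bI : ι → I) (bJ : κ → J) (bL : μ → L)
    (S : Finset (I × J × L)) (hS : ∀ a b c, t a b c ≠ 0 → (bI a, bJ b, bL c) ∈ S)
    {r b : ℕ} (α : I → Fin r → ℤ) (β : J → Fin r → ℤ) (γ : L → Fin r → ℤ)
    (hα : Function.Injective α) (hβ : Function.Injective β) (hγ : Function.Injective γ)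
    (hαb : ∀ i ρ, |α i ρ| ≤ b) (hβb : ∀ j ρ, |β j ρ| ≤ b)
    (htight : ∀ s ∈ S, ∀ ρ, α s.1 ρ + β s.2.1 ρ + γ s.2.2 ρ = 0)
    (k m n : I × J × L → ℕ) (eI : ∀ s, Fin (k s) × Fin (n s) → ι)
    (eJ : ∀ s, Fin (k s) × Fin (m s) → κ) (eL : ∀ s, Fin (m s) × Fin (n s) → μ)
    (εI : ∀ s, Fin (k s) × Fin (n s) → K) (εJ : ∀ s, Fin (k s) × Fin (m s) → K)
    (εL : ∀ s, Fin (m s) × Fin (n s) → K)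
    (heI : ∀ s ∈ S, ∀ u, bI (eI s u) = s.1) (heJ : ∀ s ∈ S, ∀ v, bJ (eJ s v) = s.2.1)
    (heL : ∀ s ∈ S, ∀ w, bL (eL s w) = s.2.2)
    (hεI : ∀ s ∈ S, ∀ u, εI s u * εI s u = 1) (hεJ : ∀ s ∈ S, ∀ v, εJ s v * εJ s v = 1)
    (hεL : ∀ s ∈ S, ∀ w, εL s w * εL s w = 1)
    (hmat : ∀ s ∈ S, ∀ u v w, t (eI s u) (eJ s v) (eL s w) =
      εI s u * εJ s v * εL s w * matMulTensor K (k s) (m s) (n s) u v w)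
    (hpos : ∀ s ∈ S, 1 ≤ k s ∧ 1 ≤ m s ∧ 1 ≤ n s)
    (dI : I → ℕ) (dJ : J → ℕ) (dL : L → ℕ) (hdI : ∀ s ∈ S, k s * n s = dI s.1)
    (hdJ : ∀ s ∈ S, k s * m s = dJ s.2.1) (hdL : ∀ s ∈ S, m s * n s = dL s.2.2)
    (Q : I × J × L → ℕ) (hQS : ∀ s, s ∉ S → Q s = 0) {N : ℕ} (hQsum : ∑ s, Q s = N)
    (F : SpectralMap K) (hF : IsUniversalSpectralPoint K F) :
    ∃ f : ℕ, 1 ≤ f ∧ f ≤ (typedSupport S N (fun i => ∑ j, ∑ l, Q (i, j, l))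
        (fun j => ∑ i, ∑ l, Q (i, j, l)) (fun l => ∑ i, ∑ j, Q (i, j, l))).card ∧
      (min (typeClass N (fun i => ∑ j, ∑ l, Q (i, j, l))).card
          (min (typeClass N (fun j => ∑ i, ∑ l, Q (i, j, l))).card
            (typeClass N (fun l => ∑ i, ∑ j, Q (i, j, l))).card) : ℝ) * f *
          rothNumberNat (3 * max f b) *
          F (matMulTensor K (∏ s, k s ^ Q s) (∏ s, m s ^ Q s) (∏ s, n s ^ Q s)) ≤
        288 * (max f b : ℝ) ^ 2 * F t ^ N := by
  classical
  set μQ : I → ℕ := fun i => ∑ j, ∑ l, Q (i, j, l) with hμQ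
  set νQ : J → ℕ := fun j => ∑ i, ∑ l, Q (i, j, l) with hνQ
  set πQ : L → ℕ := fun l => ∑ i, ∑ j, Q (i, j, l) with hπQ
  obtain ⟨φ₀, hφ₀⟩ := typedSupport_nonempty_of_counts S Q hQS hQsum
  obtain ⟨Δ, hΔΦ, hfree, f, hf1, hfΦ, hsize⟩ := exists_free_diagonal_typedSupport S α β γ hα hβ hγ
    hαb hβb htight N μQ νQ πQ ⟨φ₀, hφ₀⟩
  -- enumerate `Δ`
  set p := Δ.card with hp
  let d : Fin p → (Fin N → I) × (Fin N → J) × (Fin N → L) := fun i => (Δ.equivFin.symm i).1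
  have hdmem : ∀ i, d i ∈ Δ := fun i => (Δ.equivFin.symm i).2
  have hd : Function.Injective d := fun i i' h =>
    Δ.equivFin.symm.injective (Subtype.ext h)
  -- `t^{⊗N} ≥ ⊕_Δ ⟨∏k, ∏m, ∏n⟩` (signed components)
  have hres := tensorRestrictsTo_kroneckerPow_matMulDirectSum_of_free_signed t bI bJ bL S hS k m n
    eI eJ eL εI εJ εL heI heJ heL hεI hεJ hεL hmat d
    (fun i ρ => (mem_typedSupport.1 (hΔΦ (hdmem i))).2.2.2 ρ)
    (fun i i' i'' h => by
      have h' := hfree _ (hdmem i) _ (hdmem i') _ (hdmem i'') h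
      exact ⟨hd h'.1, hd h'.2⟩)
  -- all blocks have the format `(∏ k^Q, ∏ m^Q, ∏ n^Q)`
  have hshape := fun i => laserShape_eq S k m n dI dJ dL hdI hdJ hdL hpos Q hQS (hΔΦ (hdmem i))
  have hunit := tensorRestrictsTo_matMulDirectSum_unit_kronecker (K := K)
    (fun i => ∏ ρ, k (labelSeq (d i) ρ)) (fun i => ∏ ρ, m (labelSeq (d i) ρ))
    (fun i => ∏ ρ, n (labelSeq (d i) ρ)) (∏ s, k s ^ Q s) (∏ s, m s ^ Q s) (∏ s, n s ^ Q s)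
    (fun i => (hshape i).1) (fun i => (hshape i).2.1) (fun i => (hshape i).2.2)
  -- evaluate `F`
  set B := matMulTensor K (∏ s, k s ^ Q s) (∏ s, m s ^ Q s) (∏ s, n s ^ Q s) with hB
  have hFB0 : 0 ≤ F B := hF.nonneg _
  have hchain : (p : ℝ) * F B ≤ F t ^ N := by
    calc (p : ℝ) * F B = F (kroneckerTensor (unitTensor K p) B) := by
          rw [hF.map_kronecker, hF.map_unitTensor]
      _ ≤ F (kroneckerPow t N) := hF.mono _ _ (hres.trans hunit)
      _ = F t ^ N := hF.map_kroneckerPow t N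
  refine ⟨f, hf1, hfΦ, ?_⟩
  have hsize' : (min (typeClass N μQ).card (min (typeClass N νQ).card (typeClass N πQ).card) : ℝ) * f *
      rothNumberNat (3 * max f b) ≤ 288 * (max f b : ℝ) ^ 2 * p := by
    exact_mod_cast hsize
  calc (min (typeClass N μQ).card (min (typeClass N νQ).card (typeClass N πQ).card) : ℝ) * f *
          rothNumberNat (3 * max f b) * F B
      ≤ 288 * (max f b : ℝ) ^ 2 * p * F B := mul_le_mul_of_nonneg_right hsize' hFB0
    _ = 288 * (max f b : ℝ) ^ 2 * (p * F B) := by ring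
    _ ≤ 288 * (max f b : ℝ) ^ 2 * F t ^ N := mul_le_mul_of_nonneg_left hchain (by positivity)

end Master

/-! ## Registered stub form -/

section Stub

/-- **Stub `stub_laserSpectralMaster` of the crux skeleton of `OctSpectralDominance`
(stmt-MatrixMultiplication-7931, line `registered`)**: the ∀-closed form of `laser_spectral_master`
(labels in `Type`). [cite: BurgisserClausenShokrollahi1997, Thm. 15.41 (proof, p. 381)] -/
theorem stub_laserSpectralMaster :
    ∀ {K : Type} [Field K] {ι κ μ : Type} [Fintype ι] [Fintype κ] [Fintype μ] [DecidableEq ι] [DecidableEq κ] [DecidableEq μ] {I J L : Type} [Fintype I] [Fintype J] [Fintype L] [DecidableEq I] [DecidableEq J] [DecidableEq L] (t : ι → κ → μ → K) (bI : ι → I) (bJ : κ → J) (bL : μ → L) (S : Finset (I × J × L)), (∀ a b c, t a b c ≠ 0 → (bI a, bJ b, bL c) ∈ S) → ∀ {r b : ℕ} (α : I → Fin r → ℤ) (β : J → Fin r → ℤ) (γ : L → Fin r → ℤ), Function.Injective α → Function.Injective β → Function.Injective γ → (∀ i ρ, |α i ρ| ≤ b) → (∀ j ρ, |β j ρ| ≤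 b) → (∀ s ∈ S, ∀ ρ, α s.1 ρ + β s.2.1 ρ + γ s.2.2 ρ = 0) → ∀ (k m n : I × J × L → ℕ) (eI : ∀ s, Fin (k s) × Fin (n s) → ι) (eJ : ∀ s, Fin (k s) × Fin (m s) → κ) (eL : ∀ s, Fin (m s) × Fin (n s) → μ) (εI : ∀ s, Fin (k s) × Fin (n s) → K) (εJ : ∀ s, Fin (k s) × Fin (m s) → K) (εL : ∀ s, Fin (m s) × Fin (n s) → K), (∀ s ∈ S, ∀ u, bI (eI s u) = s.1) → (∀ s ∈ S, ∀ v, bJ (eJ s v) = s.2.1) → (∀ s ∈ S, ∀ w, bL (eL s w) = s.2.2) → (∀ s ∈ S, ∀ u, εI s u * εI s u = 1) → (∀ s ∈ S, ∀ v, εJ s v * εJ s v = 1) → (∀ s ∈ S, ∀ w, εL s w * εL s w = 1) → (∀ s ∈ S, ∀ u v w, t (eI s u) (eJ s v) (eL s w) = εI s u * εJ s v * εL s w * matMulTensor K (k s) (m s) (n s) u v w) → (∀ s ∈ S, 1 ≤ k s ∧ 1 ≤ m s ∧ 1 ≤ n s) → ∀ (dI : I → ℕ) (dJ : J → ℕ)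 (dL : L → ℕ), (∀ s ∈ S, k s * n s = dI s.1) → (∀ s ∈ S, k s * m s = dJ s.2.1) → (∀ s ∈ S, m s * n s = dL s.2.2) → ∀ (Q : I × J × L → ℕ), (∀ s, s ∉ S → Q s = 0) → ∀ {N : ℕ}, ∑ s, Q s = N → ∀ (F : SpectralMap K), IsUniversalSpectralPoint K F → ∃ f : ℕ, 1 ≤ f ∧ f ≤ (typedSupport S N (fun i => ∑ j, ∑ l, Q (i, j, l)) (fun j => ∑ i, ∑ l, Q (i, j, l)) (fun l => ∑ i, ∑ j, Q (i, j, l))).card ∧ (min (typeClass N (fun i => ∑ j, ∑ l, Q (i, j, l))).card (min (typeClass N (fun j => ∑ i, ∑ l, Q (i, j, l))).card (typeClass N (fun l => ∑ i, ∑ j, Q (i, j, l))).card) : ℝ) * f * rothNumberNat (3 * max f b) * F (matMulTensor K (∏ s, k s ^ Q s) (∏ s, m s ^ Q s) (∏ s, n s ^ Q s)) ≤ 288 * (max f b : ℝ) ^ 2 * F t ^ N := by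
  intro K _ ι κ μ _ _ _ _ _ _ I J L _ _ _ _ _ _ t bI bJ bL S hS r b α β γ hα hβ hγ hαb hβb htight k m n eI eJ
    eL εI εJ εL heI heJ heL hεI hεJ hεL hmat hpos dI dJ dL hdI hdJ hdL Q hQS N hQsum F hF
  exact laser_spectral_master t bI bJ bL S hS α β γ hα hβ hγ hαb hβb htight k m n eI eJ eL εI εJ εL heI
    heJ heL hεI hεJ hεL hmat hpos dI dJ dL hdI hdJ hdL Q hQS hQsum F hF

end Stub

end Summit.MatrixMultiplication.MatrixMultiplication.Theorems

end
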